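/-
Copyright: pub-balaban β-flow team, β-FLOW PROVER 4 (unit `b2b-balaban-beta-bflow-p4`, gen 16; coordinator ruling «YM
ACCELERATION» 2026-08-21 item (2), «work behind the as-printed interface»).  THE PLAQUETTE PULL-BACK OF AN AXIS REFLECTION ON THE
PERIOD BOX AND THE REFLECTION ORBIT OF A CUBE: the reduced pull-back (x,o) ↦ ((εx − [α∈o]e_α) mod N, o) of PARTs 29d ∕ 29e is an
involution on box points, and for the 2^d cubes of side m with corner coordinates 1 or N−1−m (one orbit of the axis reflections of the
torus) it carries the plaquettes inside the mirror cube INTO the plaquettes inside the cube — the block's binder `hSρ` for that family.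
Lattice bookkeeping; nothing of Bałaban's asserted; NOT N5 for the model, NOT BetaPertH, NOT continuum, NOT Clay.
-/
import Mathlib
import Summits.QuantumFields.BalabanUV.Beta.EriceCurvatureFormTorusCurl

/-!
# `Beta.EriceCurvatureFormTorusPullback` — PART 29h of the `EriceLoopExpansionD4` series: the reflection pull-back on the period box;
# the supports of the reflection orbit of a cube (the binder `hSρ` of PARTs 29d ∕ 29e witnessed)

Source: T. Bałaban, Commun. Math. Phys. **109** (1987) [Balaban1987RG1] (5.2)–(5.3) p. 292, (5.7) p. 293; T. Bałaban, A. Jaffe,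
*Constructive gauge theory* (Erice 1985) [BalabanJaffe1986], Part III (3.38)–(3.40) p. 245; this lineage's PART 29d
`EriceCurvatureFormHessianCovarianceTorus` (the binder `hSρ`: for (x,o) ∈ Sp_{ρY}, ((εx − [α∈o]e_α) mod N, o) ∈ Sp_Y), PART 29b
`EriceCurvatureFormTorusCurl`, PART 28b `EriceCurvatureFormTorusCovariance` (`mem_box_iff`, `emod_mem_box`, `eq_of_mem_box_of_dvd`), PART 28f
`EriceCurvatureFormTorusWitness` (the companion witness of the translation block), PART 29i `EriceCurvatureFormHessianCovarianceWitness`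
(consumer: transport of the Hessians on the same family).

THE FAMILY (letters with defining hypotheses; d arbitrary, m + 2 ≤ N).  Domains s ∈ {0,1}^d; corner y(s)_i = N−1−m if s_i = 1, else 1
(`hy`); sites P_s = the cube Π_i [y(s)_i, y(s)_i + m] (`hP`); support Sp_s = the plaquettes (x,(a,b)) with x and x + e_a + e_b in P_s
(`hSp`); the reflection of axis α flips s_α (`hρ`) — the mirror image of the cube s under x_α ↦ −x_α (mod N) is the cube ρ_α s.

WHAT IS KERNEL-CHECKED HERE (def-free; [folklore]):
* §1 `emod_eq_self_of_mem_range`, `emod_eq_add_of_neg_range`, `pullback_apply_ne` ∕ `pullback_apply_self` (coordinates of εx − [p]e_α),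
  `pullback_pullback_raw` (ε(εx − [p]e_α) − [p]e_α = x), `pullback_congr`, `dvd_emod_sub`, `mem_cube_iff`, **`pullback_pullback`** (the
  reduced pull-back is an involution on □_N).
* §2 `corner_flip`, `cube_subset_box`, **`pullback_mem_support`** — the binder `hSρ` for the orbit of cubes.
HONEST: a toy geometry (one orbit of cubes), no claim about Bałaban's domains; NOT N5 for the model, NOT (3.36), NOT B12 Thm 2, NOT
BetaPertH, NOT continuum, NOT Clay.  HONEST DEPENDENCY: continuum YM on T⁴ ⇐ BetaPertH ∧ nine spine estimates (0/9 proved); BetaPertH ⇐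
(D1) ∧ (D4) ∧ CAP+tail; G-an2-4 gates asym, D1 and NE2/3/4.
-/

namespace Summit.QuantumFields.BalabanUV.Beta.EriceCurvatureFormTorusPullback

open scoped BigOperators
open Finset
open Literature.MathematicalPhysics.QuantumFieldTheory.Balaban1983to89
open Literature.MathematicalPhysics.QuantumFieldTheory.Balaban1983to89.B7Prop1Explicit (e e_apply)
open Literature.MathematicalPhysics.QuantumFieldTheory.Balaban1983to89.Beta.PolarizationSign (axisReflect axisReflect_apply)
open Summit.QuantumFields.BalabanUV.Beta.EriceCurvatureFormTorusCovariance (mem_box_iff emod_mem_box eq_of_mem_box_of_dvd)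

variable {d : ℕ}

/-! ## §1. Arithmetic of the period box and of the pull-back -/

/-- z mod N = z for 0 ≤ z < N. [folklore] -/
theorem emod_eq_self_of_mem_range {N z : ℤ} (h0 : 0 ≤ z) (h1 : z < N) : z % N = z := Int.emod_eq_of_lt h0 h1

/-- z mod N = z + N for −N ≤ z < 0. [folklore] -/
theorem emod_eq_add_of_neg_range {N z : ℤ} (h0 : -N ≤ z) (h1 : z < 0) : z % N = z + N := by
  have h : (z + N * 1) % N = z % N := Int.add_mul_emod_self_left z N 1
  rw [mul_one] at h
  rw [← h]
  exact Int.emod_eq_of_lt (by linarith) (by linarith)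

/-- Coordinates i ≠ α of the pulled-back base point: (εx − [p]e_α)_i = x_i. [folklore] -/
theorem pullback_apply_ne (α : Fin d) (x : Fin d → ℤ) (p : Prop) [Decidable p] {i : Fin d} (hi : i ≠ α) :
    (axisReflect α x - if p then e α else 0) i = x i := by
  simp only [Pi.sub_apply, axisReflect_apply, hi, if_false]
  split_ifs
  · simp [e_apply, hi]
  · simp

/-- Coordinate α of the pulled-back base point: (εx − [p]e_α)_α = −x_α − [p]. [folklore] -/
theorem pullback_apply_self (α : Fin d) (x : Fin d → ℤ) (p : Prop) [Decidable p] :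
    (axisReflect α x - if p then e α else 0) α = -x α - (if p then 1 else 0) := by
  simp only [Pi.sub_apply, axisReflect_apply, if_true]
  split_ifs
  · simp [e_apply]
  · simp

/-- The pull-back (before reduction) is an involution: ε(εx − [p]e_α) − [p]e_α = x. [folklore] -/
theorem pullback_pullback_raw (α : Fin d) (x : Fin d → ℤ) (p : Prop) [Decidable p] :
    (axisReflect α (axisReflect α x - if p then e α else 0) - if p then e α else 0) = x := by
  funext i
  by_cases hi : i = α
  · subst hi
    rw [pullback_apply_self, pullback_apply_self]; ring
  · rw [pullback_apply_ne α _ p hi, pullback_apply_ne α _ p hi]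

/-- The pull-back (before reduction) respects coordinatewise congruence mod N. [folklore] -/
theorem pullback_congr {N : ℤ} (α : Fin d) (p : Prop) [Decidable p] {z z' : Fin d → ℤ} (h : ∀ i, N ∣ z i - z' i) (i : Fin d) :
    N ∣ (axisReflect α z - if p then e α else 0) i - (axisReflect α z' - if p then e α else 0) i := by
  by_cases hi : i = α
  · subst hi
    rw [pullback_apply_self, pullback_apply_self]
    have : -z i - (if p then (1 : ℤ) else 0) - (-z' i - if p then (1 : ℤ) else 0) = -(z i - z' i) := by ring
    rw [this, dvd_neg]
    exact h i
  · rw [pullback_apply_ne α _ p hi, pullback_apply_ne α _ p hi]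
    exact h i

/-- Reduction mod N is congruent to the identity: N ∣ (z_i mod N) − z_i. [folklore] -/
theorem dvd_emod_sub {N : ℤ} (z : Fin d → ℤ) (i : Fin d) : N ∣ z i % N - z i := by
  rw [Int.emod_def]; exact ⟨-(z i / N), by ring⟩

/-- Membership in the cube Π_i [y_i, y_i + m]. [folklore] -/
theorem mem_cube_iff {y : Fin d → ℤ} {m : ℤ} {x : Fin d → ℤ} :
    x ∈ Fintype.piFinset (fun i => Finset.Icc (y i) (y i + m)) ↔ ∀ i, y i ≤ x i ∧ x i ≤ y i + m := by
  simp only [Fintype.mem_piFinset, Finset.mem_Icc]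

/-- **The reduced pull-back is an involution on box points**: for x ∈ □_N, pulling back twice (same label) returns x. [folklore] -/
theorem pullback_pullback {N : ℤ} (hN : 0 < N) (α : Fin d) (p : Prop) [Decidable p] {x : Fin d → ℤ}
    (hx : x ∈ Fintype.piFinset (fun _ : Fin d => Finset.Ico (0 : ℤ) N)) :
    (fun i => (axisReflect α (fun j => (axisReflect α x - if p then e α else 0) j % N) - if p then e α else 0) i % N) = x := by
  refine eq_of_mem_box_of_dvd (emod_mem_box hN _) hx (fun i => ?_)
  have h1 := dvd_emod_sub (N := N) (axisReflect α (fun j => (axisReflect α x - if p then e α else 0) j % N)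
    - if p then e α else 0) i
  have h2 := pullback_congr (N := N) α p (z := fun j => (axisReflect α x - if p then e α else 0) j % N)
    (z' := axisReflect α x - if p then e α else 0) (fun j => dvd_emod_sub _ j) i
  rw [pullback_pullback_raw] at h2
  have := dvd_add h1 h2
  have e1 : (axisReflect α (fun j => (axisReflect α x - if p then e α else 0) j % N) - if p then e α else 0) i % N
        - (axisReflect α (fun j => (axisReflect α x - if p then e α else 0) j % N) - if p then e α else 0) i
      + ((axisReflect α (fun j => (axisReflect α x - if p then e α else 0) j % N) - if p then e α else 0) i - x i)
      = (axisReflect α (fun j => (axisReflect α x - if p then e α else 0) j % N) - if p then e α else 0) i % N - x i := by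
    ring
  rw [e1] at this
  exact this

/-! ## §2. The supports pull back into the mirror cube (the block's `hSρ`) -/

section Family

variable {N m : ℤ}

/-- The corner of the mirror cube: flipping s_α exchanges the two corner values at α and keeps the others. [folklore] -/
theorem corner_flip (y : (Fin d → Bool) → Fin d → ℤ) (hy : ∀ s i, y s i = if s i then N - 1 - m else 1)
    (ρ : Fin d → (Fin d → Bool) → (Fin d → Bool)) (hρ : ∀ α s, ρ α s = Function.update s α (!(s α)))
    (α : Fin d) (s : Fin d → Bool) (i : Fin d) :
    y (ρ α s) i = if i = α then (if s α then 1 else N - 1 - m) else y s i := by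
  rw [hy, hy, hρ, Function.update_apply]
  by_cases hi : i = α
  · subst hi
    simp only [if_true]
    cases s i <;> simp
  · simp only [hi, if_false]

/-- The cubes lie in the period box (m + 2 ≤ N). [folklore] -/
theorem cube_subset_box (hmN : m + 2 ≤ N) (y : (Fin d → Bool) → Fin d → ℤ)
    (hy : ∀ s i, y s i = if s i then N - 1 - m else 1) (P : (Fin d → Bool) → Finset (Fin d → ℤ))
    (hP : ∀ s, P s = Fintype.piFinset (fun i => Finset.Icc (y s i) (y s i + m))) (s : Fin d → Bool) :
    P s ⊆ Fintype.piFinset (fun _ : Fin d => Finset.Ico (0 : ℤ) N) := by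
  intro x hx
  rw [hP, mem_cube_iff] at hx
  refine mem_box_iff.2 fun i => ?_
  have h := hx i
  have hy1 : 1 ≤ y s i ∧ y s i + m ≤ N - 1 := by
    rw [hy]; split_ifs <;> constructor <;> linarith
  constructor <;> linarith [hy1.1, hy1.2]

/-- **THE BLOCK's `hSρ` FOR THE ORBIT OF CUBES.**  For a plaquette (x,o) inside the cube ρ_α s (x and x + e_{o.1} + e_{o.2} in it), the
pulled-back plaquette ((εx − [α∈o]e_α) mod N, o) lies inside the cube s. [folklore] -/
theorem pullback_mem_support (hmN : m + 2 ≤ N) (y : (Fin d → Bool) → Fin d → ℤ)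
    (hy : ∀ s i, y s i = if s i then N - 1 - m else 1) (P : (Fin d → Bool) → Finset (Fin d → ℤ))
    (hP : ∀ s, P s = Fintype.piFinset (fun i => Finset.Icc (y s i) (y s i + m)))
    (Sp : (Fin d → Bool) → Finset ((Fin d → ℤ) × {o : Fin d × Fin d // o.1 < o.2}))
    (hSp : ∀ s q, q ∈ Sp s ↔ (q.1 ∈ P s ∧ q.1 + e q.2.1.1 + e q.2.1.2 ∈ P s))
    (ρ : Fin d → (Fin d → Bool) → (Fin d → Bool)) (hρ : ∀ α s, ρ α s = Function.update s α (!(s α)))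
    (α : Fin d) (s : Fin d → Bool) :
    ∀ q ∈ Sp (ρ α s),
      ((fun i => (axisReflect α q.1 - if (α = q.2.1.1 ∨ α = q.2.1.2) then e α else 0) i % N), q.2) ∈ Sp s := by
  intro q hq
  obtain ⟨hx1, hx2⟩ := (hSp _ _).1 hq
  rw [hP, mem_cube_iff] at hx1 hx2
  have hab : q.2.1.1 ≠ q.2.1.2 := ne_of_lt q.2.2
  -- the shift [α ∈ o] equals the α-component of e_{o.1} + e_{o.2}
  have hshift : (e q.2.1.1 α : ℤ) + e q.2.1.2 α = if (α = q.2.1.1 ∨ α = q.2.1.2) then 1 else 0 := by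
    rw [e_apply, e_apply]
    by_cases h1 : α = q.2.1.1
    · have h2 : ¬ α = q.2.1.2 := fun h => hab (h1.symm.trans h)
      rw [if_pos h1, if_neg h2, if_pos (Or.inl h1)]; norm_num
    · by_cases h2 : α = q.2.1.2
      · rw [if_neg h1, if_pos h2, if_pos (Or.inr h2)]; norm_num
      · rw [if_neg h1, if_neg h2, if_neg (fun h => h.elim h1 h2)]; norm_num
  rw [hSp, hP, mem_cube_iff, mem_cube_iff]
  -- coordinatewise
  have key : ∀ i, (y s i ≤ (axisReflect α q.1 - if (α = q.2.1.1 ∨ α = q.2.1.2) then e α else 0) i % N ∧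
      (axisReflect α q.1 - if (α = q.2.1.1 ∨ α = q.2.1.2) then e α else 0) i % N ≤ y s i + m) ∧
      (y s i ≤ (axisReflect α q.1 - if (α = q.2.1.1 ∨ α = q.2.1.2) then e α else 0) i % N + e q.2.1.1 i + e q.2.1.2 i ∧
      (axisReflect α q.1 - if (α = q.2.1.1 ∨ α = q.2.1.2) then e α else 0) i % N + e q.2.1.1 i + e q.2.1.2 i ≤ y s i + m) := by
    intro i
    have h1 := hx1 i
    have h2 := hx2 i
    simp only [Pi.add_apply] at h2
    rw [corner_flip y hy ρ hρ] at h1 h2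
    by_cases hi : i = α
    · subst hi
      rw [pullback_apply_self, ← hshift]
      simp only [if_true] at h1 h2
      have hys : y s i = if s i then N - 1 - m else 1 := hy s i
      have hc : (0 : ℤ) ≤ (e q.2.1.1 i : ℤ) + e q.2.1.2 i ∧ (e q.2.1.1 i : ℤ) + e q.2.1.2 i ≤ 1 := by
        rw [hshift]; split_ifs <;> constructor <;> norm_num
      cases hsi : s i
      · -- s_α = 0: the source cube sits at N−1−m, the target at 1
        rw [hsi] at h1 h2 hys
        simp only [Bool.false_eq_true, if_false] at h1 h2 hys
        have hz : (-q.1 i - ((e q.2.1.1 i : ℤ) + e q.2.1.2 i)) % N = -q.1 i - ((e q.2.1.1 i : ℤ) + e q.2.1.2 i) + N :=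
          emod_eq_add_of_neg_range (by linarith [hc.1, hc.2]) (by linarith [hc.1, hc.2])
        rw [hz, hys]
        refine ⟨⟨by linarith [hc.1, hc.2], by linarith [hc.1, hc.2]⟩, by linarith [hc.1, hc.2], by linarith [hc.1, hc.2]⟩
      · -- s_α = 1: the source cube sits at 1, the target at N−1−m
        rw [hsi] at h1 h2 hys
        simp only [if_true] at h1 h2 hys
        have hz : (-q.1 i - ((e q.2.1.1 i : ℤ) + e q.2.1.2 i)) % N = -q.1 i - ((e q.2.1.1 i : ℤ) + e q.2.1.2 i) + N :=
          emod_eq_add_of_neg_range (by linarith [hc.1, hc.2]) (by linarith [hc.1, hc.2])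
        rw [hz, hys]
        refine ⟨⟨by linarith [hc.1, hc.2], by linarith [hc.1, hc.2]⟩, by linarith [hc.1, hc.2], by linarith [hc.1, hc.2]⟩
    · rw [pullback_apply_ne α q.1 _ hi]
      simp only [hi, if_false] at h1 h2
      have hys : 1 ≤ y s i ∧ y s i + m ≤ N - 1 := by
        rw [hy]; split_ifs <;> constructor <;> linarith
      have hmod : q.1 i % N = q.1 i := emod_eq_self_of_mem_range (by linarith [hys.1, h1.1]) (by linarith [hys.2, h1.2])
      rw [hmod]
      exact ⟨h1, h2.1, h2.2⟩
  refine ⟨fun i => (key i).1, fun i => ?_⟩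
  simp only [Pi.add_apply]
  exact (key i).2

end Family

end Summit.QuantumFields.BalabanUV.Beta.EriceCurvatureFormTorusPullback
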